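import Mathlib
import Summits.ResolutionOfSingularities.ResolutionOfSingularities.Theorems.RadicialJungCleanModelsCleanProp44ChartLocalization
import HarnessLib

/-!
# Route `RadicialJung`, crux `CleanModels` (stmt-ResolutionOfSingularities-15917), line `Sketch` rev 35, stub 6 `stub_cleanProp44` (X44c):
# THE CHART IDENTIFICATION (census (S2)), TRANSPORT LAYER — «a local ring that is a localization of `κ[u][T]` at SOME submonoid is its localization
# at `(P, T + λ)` (closed point on `Γ″`) resp. at a height-one prime `(π)` (generic point of `Γ″`)», plus the generic localization bookkeeping of the σ-tower

Seat decomp-res-hand-2 g22 (structural hand); sequel of ✓ `…ChartLocalization` (p838418), which turns `IsLocalization.AtPrime 𝒪_{E,c′} (P, T + λ)` /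
`IsLocalization.AtPrime 𝒪_{E,η″} (π)` into every hypothesis of g21's entry points.  Along the σ-tower of memo 4e §2.5 the natural invariant is WEAKER
and EASIER to transport: «the stalk is a localization of `κ(c)[u]` (resp. `κ(c)[u][T]`) at SOME submonoid» — it passes through localizations of
localizations (Mathlib `IsLocalization.localization_localization_isLocalization`), quotients (Mathlib's instance for `S ⧸ I·S` over `R ⧸ I`),
polynomial extensions (`Polynomial.isLocalization` / `MvPolynomial.isLocalization`) and ring isomorphisms of the base (`isLocalization_of_base_ringEquiv`),
which is all a chart step uses (✓ `chartQuotEquiv`, `Literature/…/BlowupChartRsop.lean`).  THIS FILE closes the gap between that invariant and the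
`AtPrime` statements:

* §1 `isLocalization_of_algebraMap_eq` (the localization property only depends on the ring map — lets the termination author replace the transported
  algebra structure by the cocone's `eval₂` structure of ✓ `tower_face` once the two agree on `κ(c)`, `u`, `T`), `isLocalizationAtPrime_comap_maximalIdeal`
  (a LOCAL localization is the localization at the contraction of its maximal ideal), `isLocalizationAtPrime_comap_maximalIdeal_of_tower` (two storeys).
* §2 closed point: `isLocalizationAtPrime_span_pair_of_mem` — if moreover `P ∈ 𝔫_S` and `T + λ ∈ 𝔫_S` (`c′` lies over the closed point `P` of the base line
  and ON `Γ″ = V(T + λ)` — the (S4)-type incidences the scheme side reads off its regular parameters), then `S` is the localization AT `(P, T + λ)`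
  (maximality, ✓ `isMaximal_span_pair`).
* §3 generic point: `exists_prime_comap_maximalIdeal_eq_span` — if every non-zero `g(u)` is a unit of `S` (the σ-curve stalks below are FIELDS: `S` lies over
  the generic point of the base line) and `𝔫_S ∩ κ[u][T] ≠ 0`, then `𝔫_S ∩ κ[u][T] = (π)` for a prime `π` (UFD: a prime element inside; a strictly larger prime
  would have height `2 = dim κ[u][T]`, hence be maximal, hence — `κ[u]` being Jacobson — contract to a MAXIMAL ideal of `κ[u]`, which is non-zero);
  `exists_prime_isLocalizationAtPrime_span` packages it as `IsLocalization.AtPrime S (π)`.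
* §4 `map_mem_maximalIdeal_pow` — the (S3) bookkeeping `x ∈ 𝔪_L^μ ⟹ f x ∈ 𝔫_S^μ` for a ring map with `f(𝔪_L) ⊆ 𝔫_S` (restriction to `E`: `f_δ ∈ J_δ ⊆ 𝔪^μ`
  at a near point gives `Φ = ε(f_δ) ∈ 𝔫^μ`, hypothesis `hΦ` of ✓ `exists_successor_of_isLocalization`).

Honest framing: OURS, elementary (Mathlib: `IsLocalization.of_le`, `Ideal.IsPrime.exists_mem_prime_of_ne_bot`, `Ideal.isMaximal_of_height_eq_ringKrullDim`,
`Polynomial.isMaximal_comap_C_of_isJacobsonRing`); the chart step itself (abstract chart data ⟹ the invariant one storey up) is the next file; nothing here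
proves X44c, any case of `CleanModels`, or resolution of singularities in characteristic `p`. [cite: Matsumura1987, Thm. 4.1–4.3 (localization), Thm. 5.1; §8]
[cite: CossartPiltant2008, Prop. 4.4 (proof, p. 11)]
-/

noncomputable section

set_option linter.dupNamespace false -- mandated namespace of this single-conjunct summit

open Polynomial IsLocalRing Literature.AlgebraicGeometry.Resolution

namespace Summit.ResolutionOfSingularities.ResolutionOfSingularities.Theorems.RadicialJung.CleanModels

/-! ## §1 Generic localization bookkeeping -/

section General

/-- **The localization property only depends on the ring map**: two algebra structures with the same `algebraMap` are localizations at `M`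
simultaneously. [folklore] -/
theorem isLocalization_of_algebraMap_eq {R S : Type*} [CommRing R] [CommRing S] (M : Submonoid R) (i₁ i₂ : Algebra R S)
    (h : ∀ r, @algebraMap R S _ _ i₁ r = @algebraMap R S _ _ i₂ r) (H : @IsLocalization R _ M S _ i₁) :
    @IsLocalization R _ M S _ i₂ := by
  letI := i₂
  refine ⟨fun m => ?_, fun z => ?_, fun {x y} hxy => ?_⟩
  · rw [← h]; exact @IsLocalization.map_units R _ M S _ i₁ H m
  · obtain ⟨⟨x, s⟩, hx⟩ := @IsLocalization.surj R _ M S _ i₁ H z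
    exact ⟨⟨x, s⟩, by rw [← h, ← h]; exact hx⟩
  · rw [← h, ← h] at hxy
    exact @IsLocalization.exists_of_eq R _ M S _ i₁ H x y hxy

variable {R S : Type*} [CommRing R] [CommRing S] [Algebra R S] (M : Submonoid R) [IsLocalization M S] [IsLocalRing S]

include M in
/-- **A local localization is the localization at the contraction of its maximal ideal.** [cite: Matsumura1987, Thm. 4.1–4.3] -/
theorem isLocalizationAtPrime_comap_maximalIdeal :
    IsLocalization.AtPrime S ((maximalIdeal S).comap (algebraMap R S)) := by
  refine IsLocalization.of_le M _ (fun m hm => ?_) (fun r hr => ?_)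
  · -- elements of `M` are units of `S`, hence not in the contraction of `𝔫_S`
    intro hm'
    have hm'' : algebraMap R S m ∈ maximalIdeal S := hm'
    exact (IsLocalRing.mem_maximalIdeal _).mp hm'' (IsLocalization.map_units S ⟨m, hm⟩)
  · -- elements outside the contraction map outside `𝔫_S`, i.e. to units
    by_contra hu
    exact hr (by rw [SetLike.mem_coe, Ideal.mem_comap]; exact (IsLocalRing.mem_maximalIdeal _).mpr hu)

variable {T : Type*} [CommRing T] [Algebra S T] [Algebra R T] [IsScalarTower R S T] (N : Submonoid S) [IsLocalization N T] [IsLocalRing T]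

include M N in
omit [IsLocalRing S] in
/-- **Two storeys**: `R → S → T` localizations at `M`, `N`, `T` local ⟹ `T` is the localization of `R` at `𝔫_T ∩ R`. [cite: Matsumura1987, Thm. 4.1–4.3] -/
theorem isLocalizationAtPrime_comap_maximalIdeal_of_tower :
    IsLocalization.AtPrime T ((maximalIdeal T).comap (algebraMap R T)) := by
  haveI := IsLocalization.localization_localization_isLocalization M N T
  exact isLocalizationAtPrime_comap_maximalIdeal (IsLocalization.localizationLocalizationSubmodule M N)

end General

/-! ## §2 Closed point: the localization is AT `(P, T + λ)` as soon as both lie in the maximal ideal -/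

section ClosedPoint

variable {k : Type*} [Field k] (P lam : k[X]) {S : Type*} [CommRing S] [Algebra (k[X])[X] S] (M : Submonoid (k[X])[X])
  [IsLocalization M S] [IsLocalRing S]

omit [IsLocalization M S] in
/-- The contraction of `𝔫_S` is `(P, T + λ)` once it contains both (`P` prime: `(P, T + λ)` is maximal). [folklore] -/
theorem comap_maximalIdeal_eq_span_pair_of_mem (hP : Prime P) (h1 : algebraMap (k[X])[X] S (C P) ∈ maximalIdeal S)
    (h2 : algebraMap (k[X])[X] S (X + C lam) ∈ maximalIdeal S) :
    (maximalIdeal S).comap (algebraMap (k[X])[X] S) = Ideal.span ({C P, X + C lam} : Set (k[X])[X]) := by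
  refine comap_maximalIdeal_eq_span_pair P lam hP ?_
  rw [Ideal.map_le_iff_le_comap, Ideal.span_le, Set.insert_subset_iff, Set.singleton_subset_iff]
  exact ⟨by rw [SetLike.mem_coe, Ideal.mem_comap]; exact h1, by rw [SetLike.mem_coe, Ideal.mem_comap]; exact h2⟩

include M in
/-- **The stalk at a closed point of `Γ″` is the localization AT `(P, T + λ)`**: a local ring which is a localization of `κ[u][T]` at some submonoid and
whose maximal ideal contains `P` and `T + λ` is `IsLocalization.AtPrime` at `𝔫₀ = (P, T + λ)` (for any `IsPrime` witness). [cite: Matsumura1987, Thm. 4.1–4.3] -/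
theorem isLocalizationAtPrime_span_pair_of_mem (hP : Prime P) (h1 : algebraMap (k[X])[X] S (C P) ∈ maximalIdeal S)
    (h2 : algebraMap (k[X])[X] S (X + C lam) ∈ maximalIdeal S)
    [(Ideal.span ({C P, X + C lam} : Set (k[X])[X])).IsPrime] :
    IsLocalization.AtPrime S (Ideal.span ({C P, X + C lam} : Set (k[X])[X])) := by
  have hcomap := comap_maximalIdeal_eq_span_pair_of_mem P lam hP h1 h2
  refine IsLocalization.of_le M _ (fun m hm => ?_) (fun r hr => ?_)
  · intro hm'
    have : m ∈ (maximalIdeal S).comap (algebraMap (k[X])[X] S) := by rw [hcomap]; exact hm'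
    rw [Ideal.mem_comap] at this
    exact (IsLocalRing.mem_maximalIdeal _).mp this (IsLocalization.map_units S ⟨m, hm⟩)
  · by_contra hu
    apply hr
    have : r ∈ (maximalIdeal S).comap (algebraMap (k[X])[X] S) := by
      rw [Ideal.mem_comap]; exact (IsLocalRing.mem_maximalIdeal _).mpr hu
    rw [hcomap] at this
    exact this

end ClosedPoint

/-! ## §3 Generic point: the contraction is a height-one prime `(π)` -/

section GenericPoint

variable {k : Type*} [Field k] {S : Type*} [CommRing S] [Algebra (k[X])[X] S] [IsLocalRing S]

/-- **`𝔫_S ∩ κ[u][T] = (π)`**: if every non-zero `g(u)` is a unit in `S` and the contraction `𝔮` of `𝔫_S` is non-zero, then `𝔮 = (π)` for a prime `π`.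
Proof: `𝔮` contains a prime element `π` (UFD); were `(π) < 𝔮`, `𝔮` would have height `≥ 2 = dim κ[u][T]`, hence be maximal, hence (`κ[u]` Jacobson)
`𝔮 ∩ κ[u]` would be a maximal — in particular non-zero — ideal of `κ[u]`. [cite: Matsumura1987, Thm. 5.1; Thm. 20.1] -/
theorem exists_prime_comap_maximalIdeal_eq_span (hC : ∀ g : k[X], g ≠ 0 → IsUnit (algebraMap (k[X])[X] S (C g)))
    (hne : (maximalIdeal S).comap (algebraMap (k[X])[X] S) ≠ ⊥) :
    ∃ π : (k[X])[X], Prime π ∧ (maximalIdeal S).comap (algebraMap (k[X])[X] S) = Ideal.span {π} := by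
  set 𝔮 := (maximalIdeal S).comap (algebraMap (k[X])[X] S) with h𝔮
  haveI h𝔮p : 𝔮.IsPrime := Ideal.comap_isPrime _ _
  -- `𝔮 ∩ κ[u] = 0`
  have h𝔮C : ∀ g : k[X], C g ∈ 𝔮 → g = 0 := by
    intro g hg
    by_contra hg0
    rw [h𝔮, Ideal.mem_comap] at hg
    exact (IsLocalRing.mem_maximalIdeal _).mp hg (hC g hg0)
  obtain ⟨π, hπ𝔮, hπ⟩ := h𝔮p.exists_mem_prime_of_ne_bot hne
  refine ⟨π, hπ, ?_⟩
  haveI hπp : (Ideal.span {π}).IsPrime := (Ideal.span_singleton_prime hπ.ne_zero).mpr hπ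
  have hle : Ideal.span {π} ≤ 𝔮 := (Ideal.span_singleton_le_iff_mem _).mpr hπ𝔮
  by_contra hne'
  have hlt : Ideal.span {π} < 𝔮 := lt_of_le_of_ne hle (Ne.symm hne')
  -- heights: `1 ≤ ht (π)`, `ht (π) + 1 ≤ ht 𝔮 ≤ dim κ[u][T] = 2`
  have h1 : (1 : ℕ∞) ≤ (Ideal.span {π}).height := by
    have h0 : (⊥ : Ideal (k[X])[X]) < Ideal.span {π} := bot_lt_iff_ne_bot.mpr (by rw [Ne, Ideal.span_singleton_eq_bot]; exact hπ.ne_zero)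
    have := Ideal.height_add_one_le_of_lt_of_isPrime h0
    rwa [Ideal.height_bot, zero_add] at this
  have h2 : (Ideal.span {π}).height + 1 ≤ 𝔮.height := Ideal.height_add_one_le_of_lt_of_isPrime hlt
  have hdim : ringKrullDim (k[X])[X] = (2 : ℕ) := by
    rw [Polynomial.ringKrullDim_of_isNoetherianRing, Polynomial.ringKrullDim_of_isNoetherianRing, ringKrullDim_eq_zero_of_field]
    rfl
  have h3 : (𝔮.height : WithBot ℕ∞) ≤ ringKrullDim (k[X])[X] := Ideal.height_le_ringKrullDim_of_ne_top h𝔮p.ne_top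
  have h3' : 𝔮.height ≤ (2 : ℕ) := by
    rw [hdim, ← WithBot.coe_natCast, WithBot.coe_le_coe] at h3
    exact h3
  have hfin : 𝔮.height ≠ ⊤ := ne_top_of_le_ne_top (ENat.coe_ne_top 2) h3'
  have h1' : (Ideal.span {π}).height ≠ ⊤ := ne_top_of_le_ne_top hfin (le_trans le_self_add h2)
  obtain ⟨a, ha⟩ := ENat.ne_top_iff_exists.mp h1'
  obtain ⟨b, hb⟩ := ENat.ne_top_iff_exists.mp hfin
  have ha1 : 1 ≤ a := by rw [← ha] at h1; exact_mod_cast h1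
  have hab : a + 1 ≤ b := by rw [← ha, ← hb] at h2; exact_mod_cast h2
  have hb2 : b ≤ 2 := by rw [← hb] at h3'; exact_mod_cast h3'
  have hb2' : b = 2 := by omega
  have h𝔮2 : 𝔮.height = (2 : ℕ) := by rw [← hb, hb2']
  -- so `𝔮` is maximal, and its contraction to `κ[u]` is maximal, hence non-zero
  haveI : FiniteRingKrullDim (k[X])[X] := by
    refine finiteRingKrullDim_iff_ne_bot_and_top.mpr ⟨?_, ?_⟩
    · rw [hdim]; exact WithBot.coe_ne_bot
    · rw [hdim, ← WithBot.coe_natCast, Ne, WithBot.coe_eq_top]; exact ENat.coe_ne_top 2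
  haveI : 𝔮.IsMaximal := Ideal.isMaximal_of_height_eq_ringKrullDim (by rw [h𝔮2, hdim]; rfl)
  have hmax : (𝔮.comap (C : k[X] →+* (k[X])[X])).IsMaximal := Polynomial.isMaximal_comap_C_of_isJacobsonRing 𝔮
  have hbot : 𝔮.comap (C : k[X] →+* (k[X])[X]) = ⊥ := by
    rw [eq_bot_iff]
    intro g hg
    rw [Ideal.mem_comap] at hg
    rw [Ideal.mem_bot]
    exact h𝔮C g hg
  rw [hbot] at hmax
  exact Polynomial.not_isField k (Ring.isField_iff_maximal_bot.mpr hmax)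

variable (M : Submonoid (k[X])[X]) [IsLocalization M S]

include M in
/-- **The stalk at the generic point of `Γ″` is the localization at a height-one prime `(π)`** (packaged with its `IsPrime` witness).
[cite: Matsumura1987, Thm. 4.1–4.3, Thm. 5.1] -/
theorem exists_prime_isLocalizationAtPrime_span (hC : ∀ g : k[X], g ≠ 0 → IsUnit (algebraMap (k[X])[X] S (C g)))
    (hne : (maximalIdeal S).comap (algebraMap (k[X])[X] S) ≠ ⊥) :
    ∃ (π : (k[X])[X]) (hπ : Prime π),
      @IsLocalization.AtPrime _ _ S _ _ (Ideal.span {π}) ((Ideal.span_singleton_prime hπ.ne_zero).mpr hπ) := by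
  obtain ⟨π, hπ, h𝔮⟩ := exists_prime_comap_maximalIdeal_eq_span hC hne
  refine ⟨π, hπ, ?_⟩
  haveI : (Ideal.span {π}).IsPrime := (Ideal.span_singleton_prime hπ.ne_zero).mpr hπ
  refine IsLocalization.of_le M _ (fun m hm => ?_) (fun r hr => ?_)
  · intro hm'
    have : m ∈ (maximalIdeal S).comap (algebraMap (k[X])[X] S) := by rw [h𝔮]; exact hm'
    rw [Ideal.mem_comap] at this
    exact (IsLocalRing.mem_maximalIdeal _).mp this (IsLocalization.map_units S ⟨m, hm⟩)
  · by_contra hu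
    apply hr
    have : r ∈ (maximalIdeal S).comap (algebraMap (k[X])[X] S) := by
      rw [Ideal.mem_comap]; exact (IsLocalRing.mem_maximalIdeal _).mpr hu
    rw [h𝔮] at this
    exact this

end GenericPoint

/-! ## §4 (S3) bookkeeping: orders pass to the exceptional divisor -/

section Orders

variable {L S : Type*} [CommRing L] [CommRing S] [IsLocalRing L] [IsLocalRing S] (f : L →+* S)

/-- `x ∈ 𝔪_L^n ⟹ f x ∈ 𝔫_S^n` for a ring map with `f(𝔪_L) ⊆ 𝔫_S` (e.g. the restriction `𝒪_{X_δ,η″} → 𝒪_{E,η″}`: a near point `η″` has `f_δ ∈ J_δ ⊆ 𝔪^μ`,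
so the face `Φ = ε(f_δ)` lies in `𝔫^μ` — hypothesis `hΦ` of ✓ `exists_successor_of_isLocalization`). [folklore] -/
theorem map_mem_maximalIdeal_pow (hf : (maximalIdeal L).map f ≤ maximalIdeal S) {n : ℕ} {x : L} (hx : x ∈ maximalIdeal L ^ n) :
    f x ∈ maximalIdeal S ^ n := by
  have h1 : f x ∈ (maximalIdeal L ^ n).map f := Ideal.mem_map_of_mem f hx
  rw [Ideal.map_pow] at h1
  exact Ideal.pow_right_mono hf n h1

/-- The same for a SURJECTIVE local map (a quotient map `L → L/K`, `K` proper): `f(𝔪_L) = 𝔫_S`, so the hypothesis is automatic. [folklore] -/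
theorem map_mem_maximalIdeal_pow_of_surjective (hf : Function.Surjective f) {n : ℕ} {x : L} (hx : x ∈ maximalIdeal L ^ n) :
    f x ∈ maximalIdeal S ^ n := by
  have hloc : IsLocalHom f := IsLocalHom.of_surjective f hf
  exact map_mem_maximalIdeal_pow f (((IsLocalRing.local_hom_TFAE f).out 0 2).mp hloc) hx

end Orders

end Summit.ResolutionOfSingularities.ResolutionOfSingularities.Theorems.RadicialJung.CleanModels

end
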